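import Literature.MathematicalPhysics.QuantumFieldTheory.Balaban1983to89.B7SectEFLinearisationRec
import Literature.MathematicalPhysics.QuantumFieldTheory.Balaban1983to89.B8Eq178Averages

/-!
# `Balaban1983to89.B8Eq178AveragesRec` — RECORD TWIN of `B8Eq178Averages` §1–§5 ([Balaban1985RegularSpaces] p. 90: the averages `ũ′ʲ` of (1.78),
# «(1.68) ⇒ (1.29)», «(1.29) for `u′u₁` ⇔ (1.78) ⇔ (1.79)») for the SYMMETRISED CENTRED block averaging (0.4) of [Balaban1987RG1]

statement-level skeleton of published theorems with citation tags; proofs where landed; nothing here is a claim about the Yang–Mills mass gap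

T. Bałaban, *Spaces of regular gauge field configurations on a lattice and gauge fixing conditions*, Commun. Math. Phys. **99** (1985) 75–102
`[Balaban1985RegularSpaces]` ("[6]"; journal page = PDF page + 74): (1.29) p. 81, (1.68)–(1.69) p. 88, (1.77)–(1.79) p. 90; T. Bałaban, *Averaging operations for
lattice gauge theories*, Commun. Math. Phys. **98** (1985) 17–51 `[Balaban1985Averaging]` ("[3]"): (78)–(80) p. 30, (178)–(179) p. 45, (208) p. 50; T. Bałaban,
*Renormalization group approach to lattice gauge field theories. I*, Commun. Math. Phys. **109** (1987) 249–301 `[Balaban1987RG1]` ("[I]"): (0.3)–(0.4) pp. 252–253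
(«a block … with a center at y»; the symmetrised loop average), pp. 253–254 («The proofs are in most cases unchanged; in others only minor and obvious
modifications are needed»).  STATUS: published, refereed.

CITATION HEADER (lean-in-tree rule).  Cell `pub-ymgap`, base `pub-ymgap-dag-n05-c` g26 — N05-REC stage 2 (director-ym №254∕№255, plan g90 SIZING WORD), item R5
(«Thm-4 driver ∕ Prop 5 ∕ Sect. E re-key for the RECORD's symmetrised centred (0.4) averaging structure»), LEAD PEN dag-n05-e g35 (brief `N05-REC-LEAD.md`
3bc4fb1e3b3a61aa, inventory `N05-REC-INVENTORY.md` e50db04501ab292d §R5 row `B8Eq178Averages`).  WHAT IS REPRODUCED = the engine module ✓`B8Eq178Averages`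
(unit `lit-balaban-r05`) §1–§5, declaration by declaration, under the cell's TOKEN RULE: (T1) `avgIter ↦ BlockAveragingZd.avgIterZ` (the (0.4) average),
(T2) corner block `blockSites L y = {L·y + boxVec L r}` ↦ CENTRED block `blockSitesZ L y = {L·y + offZ L r}` (`B7SectEFLinearisationRec.zdBlockingZ`), base point `L·y`
in both, (T3) transporters `bgT ↦ bgTZ` (the SAME (1.7) staircase `axialFn`, rooted at the centre), [3] (78)–(80) `R0avg ∕ uavg ↦ R0avgZ ∕ uavgZ`
(`B7SectCDGaugeAveragesRec`), (179) `utilG ↦ utilGZ` (`B7SectEFLinearisationRec`); declaration names = engine name with the renamed tokens.  Proofs = the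
engine proofs line by line (the block reindexing `sum_blockSitesZ_smul` is the only new bookkeeping).  Kind «definition + kernel-checked proof»: the
(1.68)∕(1.78)∕(1.79) WINDOWS `Cond168Z ∕ util178Z ∕ Cond178Z ∕ QnlZ ∕ Cond179Z` are DEFINITIONS (record twins of the engine's), the rest theorems; no
`instance`, no `notation`, no existing module modified.  `--supports stmt-QuantumFields-20541` (K0⁷-keyed, COUNT-NEUTRAL).

## WHAT IS CERTIFIED HERE (kernel; axioms `propext` ∕ `Classical.choice` ∕ `Quot.sound`)
* §1 `avgStep_bgTZ_eq_R0avgZ`, ★ `rbar_bgTZ_eq_uavgZ` — THE TWO ENCODINGS OF `R̄₀uʲ` AGREE for the record structure: [6] (1.29)'s generic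
  `Rbar (zdBlockingZ d L) (bgTZ L U₀)` IS [3] (79)–(80)'s `uavgZ L U₀ u`; `rbarZ_restr_iff_uavgZ` = (1.29) read in `uavgZ` (the record twin `Restr129Z` of
  `B8Eq119TwistedAxial.Restr129` — n05-d's R2 module — is by the LEAD's word exactly the left-hand side; the named `iff` lands with it);
  corollaries `uavgZ_one_right` (`\overline{R₀1}ʲ = 1`, twin of `B7Eq167Flat.uavg_one_right`) and `rbarZ_restr_one` (twin of `B8Thm4TruncationLocal.restr129_one`:
  `u = 1` satisfies (1.29)) from the generic `Rbar_one`.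
* §2 `utilGZ_eq_uavgZ_mul_inv` — (178) = (179) at a general background.
* §3 `rbar_bgTZ_succ_eq_one_of_block` — p. 90 «`(R̄₀u₁)^{k−1} = 1` on `B(Λ_k)` ⇒ `(R̄₀u₁)ᵏ = 1` on `Λ_k`» (the centred block contains its centre:
  `smul_mem_blockSitesZ`, any `L ≥ 1`); `Cond168Z` = (1.68) TYPED; `rbarZ_restr_of_cond168Z` = (1.68) ⇒ (1.29).
* §4 `util178Z`, `util178Z_eq_utilGZ`, `Cond178Z`, `cond178Z_iff_utilGZ`, `rbarZ_restr_mul_iff_cond178Z` — (1.78) and «(1.29) for `u′u₁` ⇔ (1.78)».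
* §5 `QnlZ`, `QnlZ_eq_mlog_utilGZ`, `Cond179Z`, `cond179Z_of_cond178Z`, `cond178Z_of_cond179Z`, `cond178Z_iff_cond179Z`, `rbarZ_restr_mul_iff_cond179Z` — (1.79) ⇔ (1.78).
* §6 `qprimeIter_bgTZ_eq_lamAvgGZ` — the two encodings of the LINEAR averaging `Q′_j(U₀)` agree (generic `QprimeIter (zdBlockingZ) (bgTZ)` = `lamAvgGZ`).

HONEST SCOPE: definitions + kernel bookkeeping (reindexing, `log 1 = 0`, `exp∘log`); NO inequality of [3]∕[6]∕[I] — in particular the engine's §3b∕§6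
(`cond178_iff_cond179_of52` over Proposition 10, `eq214_qprimeIter_of207` over (214)) are NOT twinned here: they rest on the
record twins of [3] Props 9–10 ∕ (214) (road item R1) and come as an APPEND-ONLY v1.1 when those land; §7–§9 of the engine module (`Cond177`, `ineq175`,
`Cond169`) are structure-free and REUSED BY NAME.  `HThm4Rec` UNDISCHARGED; caveat (C-S3-1) stands; N05 [B8] DISCHARGED OF RECORD untouched; COUNT 7∕28
(7∕27 excl. NODE O) · K 1∕4 UNMOVED; one finite `𝕋⁴` programme at fixed `ε`, Bałaban AS PRINTED; nothing continuum ∕ ℝ⁴ ∕ OS ∕ mass-gap ∕ Clay.  No `sorry`.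

RELATED, NOT DUPLICATED: `B8Eq178Averages` (the engine edition; its structure-free §7–§9 reused), `BlockAveragingZd` (R0a: `avgIterZ`, `offZ`),
`B7SectCDGaugeAveragesRec` (R0b-1: `SexpZ savgZ R0avgZ uavgZ`), `B7SectEFLinearisationRec` (R0b-2: `zdBlockingZ blockSitesZ bgTZ vtilGZ utilGZ`),
`B7Eq78Linearization` (generic `Rbar ∕ avgStep`, instantiated here at `zdBlockingZ`).

[cite: Balaban1985RegularSpaces, (1.29) p.81, (1.68) p.88, (1.77)–(1.79) p.90; Balaban1985Averaging, (78)–(80) p.30, (178)–(179) p.45, (208) p.50; Balaban1987RG1, (0.3)–(0.4) pp.252–253]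
-/

noncomputable section

open NormedSpace Finset

namespace Literature.MathematicalPhysics.QuantumFieldTheory.Balaban1983to89.B8Eq178AveragesRec

open B7Prop1Explicit B7Prop2Explicit MatrixLog B7Eq92Concrete B7Eq99Concrete
open B7Eq78Linearization (conjR conjR_apply Rbar Rbar_zero Rbar_succ avgStep avgStep_eq_mul_exp_sum Qprime Qprime_apply QprimeIter QprimeIter_succ)
open B7Eq170Flat (cj cj_apply bmean bmean_apply)
open BlockAveragingZd (offZ offZ_apply avgIterZ)
open B7SectCDGaugeAveragesRec (SexpZ savgZ R0avgZ uavgZ uavgZ_zero uavgZ_succ)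
open B7SectEFLinearisationRec (blockSitesZ mem_blockSitesZ zdBlockingZ bgTZ bgTZ_apply vtilGZ utilGZ utilGZ_zero utilGZ_succ rlamZ lamAvgGZ
  lamAvgGZ_succ)
open B8Eq178Averages (avgStep_eq_one)

-- `Site` alone would resolve to the torus sites of `Setup.lean`; re-export the `ℤ^d` sites of `B7Prop1Explicit`.
export B7Prop1Explicit (Site)

variable {d : ℕ}

variable {𝔸 : Type*} [NormedRing 𝔸] [NormedAlgebra ℂ 𝔸] [CompleteSpace 𝔸]

/-! ## §1 The two encodings of `R̄₀uʲ` ([3] (78)–(80)) agree for the centred (0.4) structure -/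

omit [NormedAlgebra ℂ 𝔸] [CompleteSpace 𝔸] in
/-- The centred offsets `offZ L r` are injective in `r` (coordinatewise `r_ν − (L−1)∕2`). [cite: Balaban1987RG1, (0.3) p.252] -/
theorem offZ_injective (L : ℕ) : Function.Injective (offZ (d := d) L) := by
  intro r r' h
  funext ν
  have hν := congr_fun h ν
  rw [offZ_apply, offZ_apply] at hν
  exact Fin.ext (by exact_mod_cast (sub_left_inj.mp hν))

omit [NormedAlgebra ℂ 𝔸] [CompleteSpace 𝔸] in
/-- A sum over the CENTRED block `B(y) = {L·y + offZ L r : r ∈ {0,…,L−1}ᵈ}` (`blockSitesZ`) is the sum over the centred offsets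
(record twin of the engine's private `sum_blockSites_smul`). [cite: Balaban1987RG1, (0.3) p.252] -/
theorem sum_blockSitesZ_smul {β : Type*} [AddCommMonoid β] (L : ℕ) (y : Site d) (F : Site d → β) :
    ∑ x ∈ blockSitesZ L y, F x = ∑ r : Fin d → Fin L, F ((L : ℤ) • y + offZ L r) := by
  classical
  unfold blockSitesZ
  rw [Finset.sum_image]
  intro r _ r' _ h
  exact offZ_injective L (add_left_cancel h)

/-- **One step of (78)∕(80) in the two encodings, record structure** (twin of `avgStep_bgT_eq_R0avg`): the generic twisted block average
`avgStep` on the CENTRED block `blockSitesZ L y` with weights `L⁻ᵈ` and the centre-rooted transporters `bgTZ L U₀ j y x = Ū₀ʲ(Γ_{L·y,x})`,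
evaluated on a unit-valued `v`, IS `R0avgZ L Ū₀ʲ v` at the centre `L·y` (`Ū₀ʲ = avgIterZ L U₀ j`): both are print's
`v(L·y) exp[Σ_{x∈B(L·y)} L⁻ᵈ log v(L·y)⁻¹R(Ū₀ʲ(Γ_{L·y,x}))v(x)]`. [cite: Balaban1985Averaging, (78) p.30, (80) p.30; Balaban1987RG1, (0.4) p.253] -/
theorem avgStep_bgTZ_eq_R0avgZ (L : ℕ) (U₀ : Site d → Fin d → 𝔸ˣ) (j : ℕ) (v : Site d → 𝔸ˣ) (y : Site d) :
    avgStep (blockSitesZ L y) (fun _ => ((L : ℝ) ^ d)⁻¹) (bgTZ L U₀ j y) ((v ((L : ℤ) • y) : 𝔸ˣ) : 𝔸)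
        (fun x => ((v x : 𝔸ˣ) : 𝔸))
      = ((R0avgZ L (avgIterZ L U₀ j) v ((L : ℤ) • y) : 𝔸ˣ) : 𝔸) := by
  rw [avgStep_eq_mul_exp_sum, sum_blockSitesZ_smul]
  simp only [R0avgZ, savgZ, SexpZ, Units.val_mul, R0fun_self, val_expUnit]
  refine congrArg (fun s => ((v ((L : ℤ) • y) : 𝔸ˣ) : 𝔸) * exp s) (Finset.sum_congr rfl fun r _ => ?_)
  simp only [bgTZ_apply, axialFn, add_sub_cancel_left, Ring.inverse_unit, conjR_apply, Rc_apply, Units.val_mul,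
    R0fun_apply]

/-- ★ **THE TWO ENCODINGS OF `R̄₀uʲ` AGREE, RECORD STRUCTURE** (twin of `rbar_bgT_eq_uavg`): for every `L, U₀, u` and every level `j`,
`Rbar (zdBlockingZ d L) (bgTZ L U₀) j u = (\overline{R₀u})ʲ = uavgZ L U₀ u j` — [6] (1.29)'s generic averaging over the centred blocking is
[3] (79)–(80)'s `uavgZ`. [cite: Balaban1985Averaging, (79)–(80) p.30; Balaban1985RegularSpaces, (1.29) p.81; Balaban1987RG1, (0.4) p.253] -/
theorem rbar_bgTZ_eq_uavgZ (L : ℕ) (U₀ : Site d → Fin d → 𝔸ˣ) (u : Site d → 𝔸ˣ) :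
    ∀ j : ℕ, Rbar (zdBlockingZ d L) (bgTZ L U₀) j (fun x => ((u x : 𝔸ˣ) : 𝔸)) = fun y => ((uavgZ L U₀ u j y : 𝔸ˣ) : 𝔸)
  | 0 => by
    funext y
    rw [Rbar_zero, uavgZ_zero]
  | j + 1 => by
    funext y
    rw [Rbar_succ, rbar_bgTZ_eq_uavgZ L U₀ u j, uavgZ_succ]
    exact avgStep_bgTZ_eq_R0avgZ L U₀ j (uavgZ L U₀ u j) y

/-- (1.29) for the record structure read in `uavgZ`: «`Rbar (zdBlockingZ d L) (bgTZ L U₀) j u (y) = 1` for `y ∈ Λ_j`, `j ≤ k`» (the body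
of the record twin `Restr129Z` of `B8Eq119TwistedAxial.Restr129`) iff `uavgZ L U₀ u j y = 1` there (twin of `restr129_iff_uavg`).
[cite: Balaban1985RegularSpaces, (1.29) p.81; Balaban1985Averaging, (79)–(80) p.30] -/
theorem rbarZ_restr_iff_uavgZ (L k : ℕ) (Λ : ℕ → Set (Site d)) (U₀ : Site d → Fin d → 𝔸ˣ) (u : Site d → 𝔸ˣ) :
    (∀ j, j ≤ k → ∀ y ∈ Λ j, Rbar (zdBlockingZ d L) (bgTZ L U₀) j (fun x => ((u x : 𝔸ˣ) : 𝔸)) y = 1) ↔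
      ∀ j, j ≤ k → ∀ y ∈ Λ j, uavgZ L U₀ u j y = 1 := by
  simp only [rbar_bgTZ_eq_uavgZ, Units.val_eq_one]

/-- The record averages of the identity gauge transformation are the identity: `\overline{R₀1}^j = uavgZ L U₀ 1 j = 1` (twin of
`B7Eq167Flat.uavg_one_right`; here from the generic `B7Eq78Linearization.Rbar_one` through §1's identification).
[cite: Balaban1985Averaging, (78)–(79) p.30] -/
@[simp] theorem uavgZ_one_right (L : ℕ) (U₀ : Site d → Fin d → 𝔸ˣ) (j : ℕ) : uavgZ L U₀ (1 : Site d → 𝔸ˣ) j = 1 := by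
  funext y
  have h := congr_fun (rbar_bgTZ_eq_uavgZ L U₀ (1 : Site d → 𝔸ˣ) j) y
  have h1 := congr_fun (B7Eq78Linearization.Rbar_one (zdBlockingZ d L) (bgTZ L U₀) j) y
  simp only [Pi.one_apply, Units.val_one] at h h1
  exact Units.val_eq_one.mp (h.symm.trans h1)

/-- `u = 1` satisfies (1.29) for the record structure at every level (twin of `B8Thm4TruncationLocal.restr129_one`, (1.29) written as the
body of `Restr129Z`) — the base «if we take u₁ = 1» of Theorem 4's induction; = the generic `Rbar_one`.
[cite: Balaban1985RegularSpaces, p.89 ("if we take u₁ = 1"), (1.29) p.81] -/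
theorem rbarZ_restr_one (L k : ℕ) (Λ : ℕ → Set (Site d)) (U₀ : Site d → Fin d → 𝔸ˣ) :
    ∀ j, j ≤ k → ∀ y ∈ Λ j, Rbar (zdBlockingZ d L) (bgTZ L U₀) j (fun x => (((1 : Site d → 𝔸ˣ) x : 𝔸ˣ) : 𝔸)) y = 1 := by
  intro j _ y _
  have h1 := congr_fun (B7Eq78Linearization.Rbar_one (zdBlockingZ d L) (bgTZ L U₀) j) y
  simp only [Pi.one_apply, Units.val_one] at h1 ⊢
  exact h1

/-! ## §2 (178) = (179) at a general background, record structure -/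

/-- **(178) = (179) AT A GENERAL BACKGROUND, record structure** (twin of `utilG_eq_uavg_mul_inv`): the inductively defined
`ũ′ʲ = utilGZ L U₀ u′ u₁ j` ((179), one step `vtilGZ` at `Ū₀ʲ`) is the closed form (178) `(\overline{R₀u′u₁})ʲ((\overline{R₀u₁})ʲ)⁻¹`; induction on `j`
with (80) (`uavgZ_succ`). [cite: Balaban1985Averaging, (178)–(179) p.45, (80) p.30] -/
theorem utilGZ_eq_uavgZ_mul_inv (L : ℕ) (U₀ : Site d → Fin d → 𝔸ˣ) (u' u₁ : Site d → 𝔸ˣ) :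
    ∀ j : ℕ, utilGZ L U₀ u' u₁ j = fun z => uavgZ L U₀ (u' * u₁) j z * (uavgZ L U₀ u₁ j z)⁻¹
  | 0 => by
    funext z
    rw [utilGZ_zero, uavgZ_zero, uavgZ_zero, Pi.mul_apply, mul_inv_cancel_right]
  | j + 1 => by
    have hmul : utilGZ L U₀ u' u₁ j * uavgZ L U₀ u₁ j = uavgZ L U₀ (u' * u₁) j := by
      funext z
      simp only [Pi.mul_apply, utilGZ_eq_uavgZ_mul_inv L U₀ u' u₁ j, inv_mul_cancel_right]
    funext z
    simp only [utilGZ_succ, vtilGZ, hmul, uavgZ_succ]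

/-! ## §3 p. 90: «`(R̄₀u₁)^{k−1} = 1` on `B(Λ_k)` implies `(R̄₀u₁)ᵏ = 1` on `Λ_k`», hence (1.68) ⇒ (1.29), record structure -/

omit [NormedAlgebra ℂ 𝔸] [CompleteSpace 𝔸] in
/-- For `L ≥ 1` the CENTRED block `B(y)` contains its base point `L·y` (offset `offZ L r = 0` at `r_ν = (L−1)∕2`).
[cite: Balaban1987RG1, (0.3) p.252] -/
theorem smul_mem_blockSitesZ {L : ℕ} (hL : 1 ≤ L) (y : Site d) : (L : ℤ) • y ∈ blockSitesZ L y := by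
  refine mem_blockSitesZ.2 ⟨fun _ => ⟨(L - 1) / 2, by omega⟩, ?_⟩
  have h0 : offZ L (fun _ : Fin d => (⟨(L - 1) / 2, by omega⟩ : Fin L)) = 0 := by
    funext ν
    rw [offZ_apply]
    simp
  rw [h0, add_zero]

/-- **p. 90, verbatim shape, record structure** (twin of `rbar_succ_eq_one_of_block`): if the level-`j` average is `1` on the centred block
`B(y)` below the level-`(j+1)` site `y`, the level-`(j+1)` average (80) at `y` is `1` (`L ≥ 1`, so that `B(y) ∋ L·y`).
[cite: Balaban1985RegularSpaces, p.90 (sentence before (1.78)); Balaban1985Averaging, (80) p.30] -/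
theorem rbar_bgTZ_succ_eq_one_of_block {L : ℕ} (hL : 1 ≤ L) (U₀ : Site d → Fin d → 𝔸ˣ) (u : Site d → 𝔸) (j : ℕ) (y : Site d)
    (h : ∀ x ∈ blockSitesZ L y, Rbar (zdBlockingZ d L) (bgTZ L U₀) j u x = 1) :
    Rbar (zdBlockingZ d L) (bgTZ L U₀) (j + 1) u y = 1 := by
  rw [Rbar_succ]
  show avgStep (blockSitesZ L y) (fun _ => ((L : ℝ) ^ d)⁻¹) (bgTZ L U₀ j y)
      (Rbar (zdBlockingZ d L) (bgTZ L U₀) j u ((L : ℤ) • y)) (Rbar (zdBlockingZ d L) (bgTZ L U₀) j u) = 1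
  rw [h _ (smul_mem_blockSitesZ hL y)]
  exact avgStep_eq_one _ _ _ h

/-- **(1.68) TYPED, record structure** (twin of `Cond168`; print's `k` written `k + 1`): `(\overline{R₀u₁})ʲ(y) = 1` for `y ∈ Λ_j`, `j < k`, at level
`k` for `y ∈ Λ_k`, and at level `k` on the centred blocks `B(y)`, `y ∈ Λ_{k+1}`. [cite: Balaban1985RegularSpaces, (1.68) p.88] -/
def Cond168Z (L k : ℕ) (Λ : ℕ → Set (Site d)) (U₀ : Site d → Fin d → 𝔸ˣ) (u₁ : Site d → 𝔸ˣ) : Prop :=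
  (∀ j, j < k → ∀ y ∈ Λ j, Rbar (zdBlockingZ d L) (bgTZ L U₀) j (fun x => ((u₁ x : 𝔸ˣ) : 𝔸)) y = 1) ∧
    (∀ y ∈ Λ k, Rbar (zdBlockingZ d L) (bgTZ L U₀) k (fun x => ((u₁ x : 𝔸ˣ) : 𝔸)) y = 1) ∧
    (∀ y ∈ Λ (k + 1), ∀ x ∈ blockSitesZ L y, Rbar (zdBlockingZ d L) (bgTZ L U₀) k (fun x => ((u₁ x : 𝔸ˣ) : 𝔸)) x = 1)

/-- **p. 90: «hence `u₁` satisfies the conditions (1.29)», record structure** (twin of `restr129_of_cond168`, conclusion = the body of `Restr129Z`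
with `k + 1` levels), for `L ≥ 1`. [cite: Balaban1985RegularSpaces, p.90 (sentence before (1.78)), (1.68) p.88, (1.29) p.81] -/
theorem rbarZ_restr_of_cond168Z {L : ℕ} (hL : 1 ≤ L) {k : ℕ} {Λ : ℕ → Set (Site d)} {U₀ : Site d → Fin d → 𝔸ˣ}
    {u₁ : Site d → 𝔸ˣ} (h : Cond168Z L k Λ U₀ u₁) :
    ∀ j, j ≤ k + 1 → ∀ y ∈ Λ j, Rbar (zdBlockingZ d L) (bgTZ L U₀) j (fun x => ((u₁ x : 𝔸ˣ) : 𝔸)) y = 1 := by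
  obtain ⟨hlt, hk, hblk⟩ := h
  intro j hj y hy
  rcases Nat.lt_or_ge j k with hjk | hjk
  · exact hlt j hjk y hy
  · rcases Nat.eq_or_lt_of_le hjk with rfl | hkj
    · exact hk y hy
    · obtain rfl : j = k + 1 := le_antisymm hj hkj
      exact rbar_bgTZ_succ_eq_one_of_block hL U₀ _ k y (hblk y hy)

/-! ## §4 (1.78), and «(1.29) for `u′u₁` ⇔ (1.78)», record structure -/

/-- **The averages `ũ′ʲ` of (1.78) ∕ [3] (178), record structure** (twin of `util178`): `ũ′ʲ(y) = (\overline{R₀u′u₁})ʲ(y)·((\overline{R₀u₁})ʲ(y))⁻¹` built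
from the centred averaging `Rbar (zdBlockingZ d L) (bgTZ L U₀)`; `= utilGZ` (`util178Z_eq_utilGZ`). [cite: Balaban1985RegularSpaces, (1.78) p.90; Balaban1985Averaging, (178) p.45] -/
def util178Z (L : ℕ) (U₀ : Site d → Fin d → 𝔸ˣ) (u' u₁ : Site d → 𝔸ˣ) (j : ℕ) (y : Site d) : 𝔸 :=
  Rbar (zdBlockingZ d L) (bgTZ L U₀) j (fun x => (((u' * u₁) x : 𝔸ˣ) : 𝔸)) y *
    Ring.inverse (Rbar (zdBlockingZ d L) (bgTZ L U₀) j (fun x => ((u₁ x : 𝔸ˣ) : 𝔸)) y)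

/-- `ũ′ʲ` of (1.78) IS `utilGZ` ((179)), record structure (twin of `util178_eq_utilG`), by §1 and §2.
[cite: Balaban1985RegularSpaces, (1.78) p.90; Balaban1985Averaging, (178)–(179) p.45] -/
theorem util178Z_eq_utilGZ (L : ℕ) (U₀ : Site d → Fin d → 𝔸ˣ) (u' u₁ : Site d → 𝔸ˣ) (j : ℕ) (y : Site d) :
    util178Z L U₀ u' u₁ j y = ((utilGZ L U₀ u' u₁ j y : 𝔸ˣ) : 𝔸) := by
  rw [util178Z, rbar_bgTZ_eq_uavgZ L U₀ (u' * u₁) j, rbar_bgTZ_eq_uavgZ L U₀ u₁ j, utilGZ_eq_uavgZ_mul_inv L U₀ u' u₁ j]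
  simp only [Ring.inverse_unit, Units.val_mul]

/-- **(1.78) TYPED, record structure** (twin of `Cond178`): `ũ′ʲ = 1` on `Λ_j`, `j ≤ k`. [cite: Balaban1985RegularSpaces, (1.78) p.90] -/
def Cond178Z (L k : ℕ) (Λ : ℕ → Set (Site d)) (U₀ : Site d → Fin d → 𝔸ˣ) (u' u₁ : Site d → 𝔸ˣ) : Prop :=
  ∀ j, j ≤ k → ∀ y ∈ Λ j, util178Z L U₀ u' u₁ j y = 1

/-- (1.78) in the (179) objects, record structure (twin of `cond178_iff_utilG`). [cite: Balaban1985RegularSpaces, (1.78) p.90; Balaban1985Averaging, (179) p.45] -/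
theorem cond178Z_iff_utilGZ (L k : ℕ) (Λ : ℕ → Set (Site d)) (U₀ : Site d → Fin d → 𝔸ˣ) (u' u₁ : Site d → 𝔸ˣ) :
    Cond178Z L k Λ U₀ u' u₁ ↔ ∀ j, j ≤ k → ∀ y ∈ Λ j, utilGZ L U₀ u' u₁ j y = 1 := by
  unfold Cond178Z
  simp only [util178Z_eq_utilGZ, Units.val_eq_one]

/-- **p. 90: «`u₁` satisfies (1.29) and we may write these conditions for `u′u₁` as (1.78)», record structure** (twin of
`restr129_mul_iff_cond178`, (1.29) written as the body of `Restr129Z`). [cite: Balaban1985RegularSpaces, (1.78) p.90, (1.29) p.81] -/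
theorem rbarZ_restr_mul_iff_cond178Z {L k : ℕ} {Λ : ℕ → Set (Site d)} {U₀ : Site d → Fin d → 𝔸ˣ} {u₁ : Site d → 𝔸ˣ}
    (h₁ : ∀ j, j ≤ k → ∀ y ∈ Λ j, Rbar (zdBlockingZ d L) (bgTZ L U₀) j (fun x => ((u₁ x : 𝔸ˣ) : 𝔸)) y = 1) (u' : Site d → 𝔸ˣ) :
    (∀ j, j ≤ k → ∀ y ∈ Λ j, Rbar (zdBlockingZ d L) (bgTZ L U₀) j (fun x => (((u' * u₁) x : 𝔸ˣ) : 𝔸)) y = 1) ↔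
      Cond178Z L k Λ U₀ u' u₁ := by
  unfold Cond178Z
  refine forall₂_congr fun j hj => forall₂_congr fun y hy => ?_
  rw [util178Z, h₁ j hj y hy, Ring.inverse_one, mul_one]

/-! ## §5 (1.79) ⇔ (1.78), record structure -/

/-- **(208) ∕ (1.79), record structure** (twin of `Qnl`): `Q′_j(u₁, λ)(y) := log ũ′ʲ(y)`, `log` = the series (21) `MatrixLog.mlog`.
[cite: Balaban1985RegularSpaces, (1.79) p.90; Balaban1985Averaging, (208) p.50] -/
def QnlZ (L : ℕ) (U₀ : Site d → Fin d → 𝔸ˣ) (u' u₁ : Site d → 𝔸ˣ) (j : ℕ) (y : Site d) : 𝔸 :=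
  mlog (util178Z L U₀ u' u₁ j y)

/-- `Q′_j(u₁, λ) = log ũ′ʲ` in the (179) objects, record structure (twin of `Qnl_eq_mlog_utilG`). [cite: Balaban1985Averaging, (208) p.50] -/
theorem QnlZ_eq_mlog_utilGZ (L : ℕ) (U₀ : Site d → Fin d → 𝔸ˣ) (u' u₁ : Site d → 𝔸ˣ) (j : ℕ) (y : Site d) :
    QnlZ L U₀ u' u₁ j y = mlog ((utilGZ L U₀ u' u₁ j y : 𝔸ˣ) : 𝔸) := by
  rw [QnlZ, util178Z_eq_utilGZ]

/-- **(1.79) TYPED, record structure** (twin of `Cond179`): `Q′(u₁, λ) = 0` on `𝔅_k`. [cite: Balaban1985RegularSpaces, (1.79) p.90] -/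
def Cond179Z (L k : ℕ) (Λ : ℕ → Set (Site d)) (U₀ : Site d → Fin d → 𝔸ˣ) (u' u₁ : Site d → 𝔸ˣ) : Prop :=
  ∀ j, j ≤ k → ∀ y ∈ Λ j, QnlZ L U₀ u' u₁ j y = 0

/-- (1.78) ⇒ (1.79), record structure: `log 1 = 0` (twin of `cond179_of_cond178`). [cite: Balaban1985RegularSpaces, (1.78)–(1.79) p.90] -/
theorem cond179Z_of_cond178Z {L k : ℕ} {Λ : ℕ → Set (Site d)} {U₀ : Site d → Fin d → 𝔸ˣ} {u' u₁ : Site d → 𝔸ˣ}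
    (h : Cond178Z L k Λ U₀ u' u₁) : Cond179Z L k Λ U₀ u' u₁ := fun j hj y hy => by
  rw [QnlZ, h j hj y hy, mlog_one]

/-- (1.79) ⇒ (1.78) on the domain of the logarithm, record structure (twin of `cond178_of_cond179`).
[cite: Balaban1985RegularSpaces, (1.78)–(1.79) p.90; Balaban1985Averaging, (21) p.21] -/
theorem cond178Z_of_cond179Z {L k : ℕ} {Λ : ℕ → Set (Site d)} {U₀ : Site d → Fin d → 𝔸ˣ} {u' u₁ : Site d → 𝔸ˣ}
    (hdom : ∀ j, j ≤ k → ∀ y ∈ Λ j, ‖util178Z L U₀ u' u₁ j y - 1‖ < 1) (h : Cond179Z L k Λ U₀ u' u₁) :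
    Cond178Z L k Λ U₀ u' u₁ := fun j hj y hy => by
  have h0 : mlog (util178Z L U₀ u' u₁ j y) = 0 := h j hj y hy
  rw [← exp_mlog (hdom j hj y hy), h0, exp_zero]

/-- **(1.78) ⇔ (1.79), record structure** («or equivalently», p. 90) under the domain condition `‖ũ′ʲ(y) − 1‖ < 1` on `𝔅_k` (twin of
`cond178_iff_cond179`). [cite: Balaban1985RegularSpaces, (1.78)–(1.79) p.90] -/
theorem cond178Z_iff_cond179Z {L k : ℕ} {Λ : ℕ → Set (Site d)} {U₀ : Site d → Fin d → 𝔸ˣ} {u' u₁ : Site d → 𝔸ˣ}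
    (hdom : ∀ j, j ≤ k → ∀ y ∈ Λ j, ‖util178Z L U₀ u' u₁ j y - 1‖ < 1) :
    Cond178Z L k Λ U₀ u' u₁ ↔ Cond179Z L k Λ U₀ u' u₁ :=
  ⟨cond179Z_of_cond178Z, cond178Z_of_cond179Z hdom⟩

/-- **p. 90, the whole sentence, record structure** (twin of `restr129_mul_iff_cond179`, (1.29) written as the body of `Restr129Z`): if `u₁`
satisfies (1.29) and `ũ′ʲ` stays in the domain of the logarithm on `𝔅_k`, then «`u′u₁` satisfies (1.29)» ⇔ (1.79).
[cite: Balaban1985RegularSpaces, (1.78)–(1.79) p.90, (1.29) p.81] -/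
theorem rbarZ_restr_mul_iff_cond179Z {L k : ℕ} {Λ : ℕ → Set (Site d)} {U₀ : Site d → Fin d → 𝔸ˣ} {u₁ : Site d → 𝔸ˣ}
    (h₁ : ∀ j, j ≤ k → ∀ y ∈ Λ j, Rbar (zdBlockingZ d L) (bgTZ L U₀) j (fun x => ((u₁ x : 𝔸ˣ) : 𝔸)) y = 1) {u' : Site d → 𝔸ˣ}
    (hdom : ∀ j, j ≤ k → ∀ y ∈ Λ j, ‖util178Z L U₀ u' u₁ j y - 1‖ < 1) :
    (∀ j, j ≤ k → ∀ y ∈ Λ j, Rbar (zdBlockingZ d L) (bgTZ L U₀) j (fun x => (((u' * u₁) x : 𝔸ˣ) : 𝔸)) y = 1) ↔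
      Cond179Z L k Λ U₀ u' u₁ :=
  (rbarZ_restr_mul_iff_cond178Z h₁ u').trans (cond178Z_iff_cond179Z hdom)

/-! ## §6 The two encodings of the LINEAR averaging `Q′_j(U₀)` agree, record structure ([3] (212)–(213) ∕ [4] (3.19)) -/

/-- **THE TWO ENCODINGS OF `Q′_j(U₀)` AGREE, RECORD STRUCTURE** (twin of `qprimeIter_bgT_eq_lamAvgG`): the generic linear averaging
`QprimeIter (zdBlockingZ d L) (bgTZ L U₀) j` ([4] (3.19) on the CENTRED blocks with the centre-rooted transporters `Ū₀ʲ(Γ_{L·y,x})`; the operator whose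
null space defines (1.27)–(1.29) for the record structure) IS `B7SectEFLinearisationRec.lamAvgGZ L U₀ j` ((212)–(213) of [3], recursion (77)∕(80)), for
every `L, U₀, μ, j`. [cite: Balaban1985Averaging, (212)–(213) p.50, (77)–(80) p.30; Balaban1985RegularSpaces, p.80 (sentence before (1.27)); Balaban1987RG1, (0.4) p.253] -/
theorem qprimeIter_bgTZ_eq_lamAvgGZ (L : ℕ) (U₀ : Site d → Fin d → 𝔸ˣ) (μ : Site d → 𝔸) :
    ∀ j : ℕ, QprimeIter (zdBlockingZ d L) (bgTZ L U₀) j μ = lamAvgGZ L U₀ j μ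
  | 0 => rfl
  | j + 1 => by
    funext y
    rw [QprimeIter_succ, lamAvgGZ_succ, qprimeIter_bgTZ_eq_lamAvgGZ L U₀ μ j]
    show Qprime (blockSitesZ L y) (fun _ => ((L : ℝ) ^ d)⁻¹) (bgTZ L U₀ j y) (lamAvgGZ L U₀ j μ) = _
    rw [Qprime_apply, sum_blockSitesZ_smul]
    simp only [rlamZ, bmean_apply]
    refine Finset.sum_congr rfl fun r _ => ?_
    simp only [bgTZ_apply, axialFn, add_sub_cancel_left, conjR_apply, cj_apply]

end Literature.MathematicalPhysics.QuantumFieldTheory.Balaban1983to89.B8Eq178AveragesRec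

end
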